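import Summits.HodgeConjecture.CorCM.QuarticCMReflexInOcticHodge
import HarnessLib

/-!
# Both behaviours occur: for every fourfold type in the reflex configuration there are surface types of BOTH kinds

COR-CM (cell `pub-hodgecm2`, binder seat `b16` gen 40, count-neutral claim SxF-ONECONJ (F7)); NEW as stated, hence under
`Summits/`.  Theorems only; no definition, no named fact, no `sorry`.

`QuarticCMReflexInOcticHodge` (F5) decides the pair `(K; Ψ)`, `(K_F; Θ)` — `K` a non-Galois quartic CM field, `K_F` an
octic containing the other quartic class `M` of the Galois closure `L` of `K`, `ψ₀ : M → ℂ` the unsplit embedding of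
`Θ` — by the position of `Ψ` relative to the stabiliser `Stab(ψ₀) ⊆ Aut(ℂ)`: DEGENERATE iff `Stab(ψ₀)` stabilises
`Ψ`, nondegenerate iff some element of `Stab(ψ₀)` moves `Ψ`.  This file shows that BOTH cases occur for every `ψ₀`
(`K ≇ M`): `Stab(ψ₀)` acts on `Hom(K, ℂ)` through `{1, γ₀}` for a fixed-point-free involution `γ₀` commuting with
complex conjugation and different from it (a reflection of the dihedral group through an edge axis, in the picture
where the embeddings of `K` are the vertices of a square and those of `M` its edges), so the two types `{a, γ₀a}`,
`{ā, γ₀ā}` are stabilised and the two types `{a, \overline{γ₀a}}`, `{ā, γ₀ a}` are moved.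

* §1 `forall_smul_eq_smul_of_normalClosure_eq` (transfer `Hom(M, ℂ) → Hom(K, ℂ)` of the action of two automorphisms),
  `forall_smul_eq_of_smul_eq_of_smul_eq` (an automorphism fixing one embedding of `K` and one of `M` fixes `L`:
  `a(K)·ψ₀(M) = L`), **`exists_edgeReflection`** (`γ₀ ∈ Stab(ψ₀)` with `γ₀a ∉ {a, ā}`, `γ₀² = 1` on `Hom(K, ℂ)`),
  **`smul_eq_or_smul_eq_of_smul_eq`** (`Stab(ψ₀)` acts through `{1, γ₀}`).
* §2 **`exists_cmType_stabilizer_and_exists_not`** — there are CM types `Ψ`, `Ψ'` of `K` with `Stab(ψ₀)` stabilising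
  `Ψ` and some element of `Stab(ψ₀)` moving `Ψ'`.  With F5/F6: for EVERY simple CM fourfold `F` of the reflex
  configuration with nondegenerate type there are simple CM surfaces `S`, `S'` with CM by `K` such that `B• = D•` holds
  on all `S'^a × F^b` and FAILS on some `S^a × F^b`.

## References

* [Shimura1998] G. Shimura, *Abelian Varieties with Complex Multiplication and Modular Functions*, §8.3 Prop. 28,
  §8.4 Example (2)(C).
* [MoonenZarhin1999LowDim] B. Moonen, Yu. Zarhin, *Hodge classes on abelian varieties of low dimension*, Math. Ann.
  315 (1999), "Hodge groups of simple abelian surfaces of CM-type".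
-/

noncomputable section

open NumberField NumberField.ComplexEmbedding IntermediateField Module

namespace Summit.HodgeConjecture.CorCM

open Literature.NumberTheory.ComplexMultiplication
open Literature.AlgebraicGeometry.Motives (CMType)
open Literature.AlgebraicGeometry.Pohlmann1968

variable {K M : Type} [Field K] [NumberField K] [IsCMField K] [Field M] [NumberField M] [IsCMField M]

/-! ## §1 The edge reflection -/

omit [IsCMField K] [IsCMField M] in
/-- **Transfer**: two automorphisms of `ℂ` agreeing on every embedding of `M` agree on every embedding of `K`, when
`K` and `M` have the same Galois closure in `ℂ`. [cite: Shimura1998, §8.4 Example (2)(C)] -/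
theorem forall_smul_eq_smul_of_normalClosure_eq (hLL : normalClosure ℚ M ℂ = normalClosure ℚ K ℂ)
    {n n' : ℂ ≃+* ℂ} (hn : ∀ x : M →+* ℂ, n • x = n' • x) (z : K →+* ℂ) : n • z = n' • z := by
  refine RingHom.ext fun w => ?_
  rw [ringEquiv_smul_apply, ringEquiv_smul_apply]
  exact apply_eq_of_forall_smul_eq (I := Unit) (K := fun _ => M) () hn
    (hLL ▸ apply_mem_normalClosure (I := Unit) (K := fun _ => K) () z w)

/-- A subfield of a finite extension (inside `ℂ`) is finite. [folklore] -/
private theorem finiteDimensional_of_le₁₉ {F F' : IntermediateField ℚ ℂ} [FiniteDimensional ℚ F] (h : F' ≤ F) :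
    FiniteDimensional ℚ F' :=
  FiniteDimensional.of_injective (IntermediateField.inclusion h).toLinearMap (IntermediateField.inclusion_injective h)

/-- `[s(K) : ℚ] = [K : ℚ]`. [folklore] -/
private theorem finrank_fieldRange₁₉ {F : Type} [Field F] [NumberField F] (s : F →+* ℂ) :
    finrank ℚ s.toRatAlgHom.fieldRange = finrank ℚ F :=
  (AlgEquiv.ofInjectiveField s.toRatAlgHom).toLinearEquiv.finrank_eq.symm

omit [IsCMField M] in
/-- **An automorphism of `ℂ` fixing one embedding of `K` and one embedding of `M` fixes every embedding of `K`**
(`K`, `M` non-isomorphic quartic fields with the same Galois closure `L` of degree `8`: `a(K)·ψ₀(M) = L`).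
[cite: Shimura1998, §8.4 Example (2)(C)] -/
theorem forall_smul_eq_of_smul_eq_of_smul_eq (h4 : finrank ℚ K = 4) (hK : ¬ IsGalois ℚ K) (h4M : finrank ℚ M = 4)
    (hLL : normalClosure ℚ M ℂ = normalClosure ℚ K ℂ) (hKM : IsEmpty (K →+* M)) {h : ℂ ≃+* ℂ} {a : K →+* ℂ}
    {ψ₀ : M →+* ℂ} (ha : h • a = a) (hψ : h • ψ₀ = ψ₀) (z : K →+* ℂ) : h • z = z := by
  haveI : FiniteDimensional ℚ a.toRatAlgHom.fieldRange :=
    LinearEquiv.finiteDimensional (AlgEquiv.ofInjectiveField a.toRatAlgHom).toLinearEquiv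
  haveI : FiniteDimensional ℚ ψ₀.toRatAlgHom.fieldRange :=
    LinearEquiv.finiteDimensional (AlgEquiv.ofInjectiveField ψ₀.toRatAlgHom).toLinearEquiv
  -- the compositum `a(K) ⊔ ψ₀(M)` is the Galois closure `L`
  set C : IntermediateField ℚ ℂ := a.toRatAlgHom.fieldRange ⊔ ψ₀.toRatAlgHom.fieldRange with hC
  have hCle : C ≤ normalClosure ℚ K ℂ :=
    sup_le (AlgHom.fieldRange_le_normalClosure _) (hLL ▸ AlgHom.fieldRange_le_normalClosure _)
  haveI : FiniteDimensional ℚ C := finiteDimensional_of_le₁₉ hCle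
  have h8 : finrank ℚ ↥(normalClosure ℚ K ℂ) = 8 := DihedralReflexPair.finrank_normalClosure_eq_eight h4 hK
  have hd₁ : 4 ∣ finrank ℚ C := by
    rw [← h4, ← finrank_fieldRange₁₉ a]; exact IntermediateField.finrank_dvd_of_le_right le_sup_left
  have hd₂ : finrank ℚ C ∣ 8 := h8 ▸ IntermediateField.finrank_dvd_of_le_right hCle
  have hne : finrank ℚ C ≠ 4 := by
    intro hC4
    -- then `a(K) = C ⊇ ψ₀(M)`, and `ψ₀(M) = a(K)`: an isomorphism `K ≅ M`
    have h1 : a.toRatAlgHom.fieldRange = C :=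
      IntermediateField.eq_of_le_of_finrank_eq le_sup_left (by rw [finrank_fieldRange₁₉, h4, hC4])
    have h2 : ψ₀.toRatAlgHom.fieldRange = a.toRatAlgHom.fieldRange :=
      IntermediateField.eq_of_le_of_finrank_eq (h1 ▸ le_sup_right)
        (by rw [finrank_fieldRange₁₉, finrank_fieldRange₁₉, h4, h4M])
    exact hKM.false ((AlgEquiv.ofInjectiveField a.toRatAlgHom).trans
      ((IntermediateField.equivOfEq h2.symm).trans (AlgEquiv.ofInjectiveField ψ₀.toRatAlgHom).symm)
      |>.toRingEquiv.toRingHom)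
  have hC8 : finrank ℚ C = 8 := by
    obtain ⟨m, hm⟩ := hd₁
    have hm' : 4 * m ∣ 8 := hm ▸ hd₂
    have hmle : m ≤ 2 := by
      have := Nat.le_of_dvd (by norm_num) hm'; omega
    interval_cases m <;> simp_all
  have hCeq : C = normalClosure ℚ K ℂ := IntermediateField.eq_of_le_of_finrank_eq hCle (by rw [hC8, h8])
  -- `h` fixes `a(K)` and `ψ₀(M)` pointwise, hence `C = L`
  have hfix : ∀ x ∈ C, h x = x := by
    let φ : ℂ →ₐ[ℚ] ℂ := (AlgEquiv.ofRingEquiv (f := h) fun q => by rw [eq_ratCast]; exact map_ratCast h q).toAlgHom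
    let D : IntermediateField ℚ ℂ :=
      ⟨AlgHom.equalizer φ (AlgHom.id ℚ ℂ), fun y (hy : h y = y) => show h y⁻¹ = y⁻¹ by rw [map_inv₀, hy]⟩
    have hle : C ≤ D := by
      refine sup_le ?_ ?_
      · rintro _ ⟨k, rfl⟩
        change h (a k) = a k
        rw [← ringEquiv_smul_apply h a k, ha]
      · rintro _ ⟨m, rfl⟩
        change h (ψ₀ m) = ψ₀ m
        rw [← ringEquiv_smul_apply h ψ₀ m, hψ]
    exact fun x hx => hle hx
  refine RingHom.ext fun w => ?_
  rw [ringEquiv_smul_apply]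
  exact hfix _ (hCeq ▸ apply_mem_normalClosure (I := Unit) (K := fun _ => K) () z w)

/-- **The edge reflection.**  `K`, `M` non-isomorphic non-Galois quartic CM fields with the same Galois closure,
`ψ₀ : M → ℂ`: some `γ₀ ∈ Aut(ℂ)` fixes `ψ₀`, moves EVERY embedding `a` of `K` off its conjugate pair
(`γ₀a ∉ {a, ā}`), and squares to the identity on `Hom(K, ℂ)`; moreover it conjugates some embedding `t ∉ {ψ₀, ψ̄₀}`
of `M`. [cite: Shimura1998, §8.4 Example (2)(C)] -/
theorem exists_edgeReflection (h4 : finrank ℚ K = 4) (hK : ¬ IsGalois ℚ K) (h4M : finrank ℚ M = 4)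
    (hM : ¬ IsGalois ℚ M) (hLL : normalClosure ℚ M ℂ = normalClosure ℚ K ℂ) (hKM : IsEmpty (K →+* M))
    (ψ₀ : M →+* ℂ) :
    ∃ (γ₀ : ℂ ≃+* ℂ) (t : M →+* ℂ), γ₀ • ψ₀ = ψ₀ ∧ t ≠ ψ₀ ∧ t ≠ conjugate ψ₀ ∧ γ₀ • t = conjugate t ∧
      (∀ a : K →+* ℂ, γ₀ • a ≠ a ∧ γ₀ • a ≠ conjugate a ∧ γ₀ • γ₀ • a = a) := by
  obtain ⟨γ₀, t, hγψ, hγt⟩ := NonGaloisField.exists_ringEquiv_comp_eq_and_comp_ne hM ψ₀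
  have hγψ' : γ₀ • ψ₀ = ψ₀ := hγψ
  have hγt' : γ₀ • t ≠ t := hγt
  have hγψc : γ₀ • conjugate ψ₀ = conjugate ψ₀ := by
    rw [QuarticCM.smul_conjugate, hγψ']
  have ht₀ : t ≠ ψ₀ := fun h => hγt' (by rw [h, hγψ'])
  have ht₀' : t ≠ conjugate ψ₀ := fun h => hγt' (by rw [h, hγψc])
  -- `γ₀ t = t̄`
  have hγtc : γ₀ • t = conjugate t := by
    rcases QuarticCM.eq_or_eq_or_eq_or_eq h4M ht₀ ht₀' (γ₀ • t) with h | h | h | h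
    · exact absurd (smul_left_cancel γ₀ (h.trans hγψ'.symm)) ht₀
    · exact absurd (smul_left_cancel γ₀ (h.trans hγψc.symm)) ht₀'
    · exact absurd h hγt'
    · exact h
  -- `γ₀` on `Hom(K, ℂ)`
  have hconjK : ∀ a : K →+* ℂ, γ₀ • conjugate a = conjugate (γ₀ • a) := fun a => QuarticCM.smul_conjugate γ₀ a
  have hfixK : ∀ a : K →+* ℂ, γ₀ • a ≠ a := fun a ha =>
    hγt' (by
      have hall := forall_smul_eq_of_smul_eq_of_smul_eq h4 hK h4M hLL hKM ha hγψ'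
      exact forall_smul_eq_smul_of_normalClosure_eq hLL.symm (n' := 1) (fun z => by rw [one_smul]; exact hall z) t
        |>.trans (one_smul _ _))
  have hsq : ∀ a : K →+* ℂ, γ₀ • γ₀ • a = a := fun a => by
    -- `γ₀²` fixes `ψ₀` and `t`, hence all four embeddings of `M`, hence `L`
    have h2t : (γ₀ * γ₀) • t = t := by
      rw [mul_smul, hγtc, QuarticCM.smul_conjugate, hγtc]
      exact ComplexEmbedding.involutive_conjugate M t
    have h2ψ : (γ₀ * γ₀) • ψ₀ = ψ₀ := by rw [mul_smul, hγψ', hγψ']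
    have h2ψc : (γ₀ * γ₀) • conjugate ψ₀ = conjugate ψ₀ := by rw [mul_smul, hγψc, hγψc]
    have h2tc : (γ₀ * γ₀) • conjugate t = conjugate t := by
      rw [QuarticCM.smul_conjugate, h2t]
    have hallM : ∀ x : M →+* ℂ, (γ₀ * γ₀) • x = (1 : ℂ ≃+* ℂ) • x := fun x => by
      rw [one_smul]
      rcases QuarticCM.eq_or_eq_or_eq_or_eq h4M ht₀ ht₀' x with h | h | h | h <;> rw [h]
      · exact h2ψ
      · exact h2ψc
      · exact h2t
      · exact h2tc
    have := forall_smul_eq_smul_of_normalClosure_eq hLL hallM a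
    rwa [one_smul, mul_smul] at this
  refine ⟨γ₀, t, hγψ', ht₀, ht₀', hγtc, fun a => ⟨hfixK a, fun hac => ?_, hsq a⟩⟩
  -- `γ₀ a = ā` would make `γ₀` complex conjugation on `Hom(K, ℂ)`, hence on `Hom(M, ℂ)`: but `γ₀ ψ₀ = ψ₀`
  classical
  obtain ⟨b, hba, hba'⟩ : ∃ b : K →+* ℂ, b ≠ a ∧ b ≠ conjugate a := by
    -- `Hom(K, ℂ)` has four elements, so some embedding lies outside `{a, ā}`
    by_contra hnone
    push Not at hnone
    have hcard := QuarticCM.card_ringHom_eq_four (K := K) h4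
    have hsub : (Finset.univ : Finset (K →+* ℂ)) ⊆ {a, conjugate a} := fun b _ => by
      by_cases hb : b = a
      · simp [hb]
      · simp [hnone b hb]
    have h1 := Finset.card_le_card hsub
    have h2 : ({a, conjugate a} : Finset (K →+* ℂ)).card ≤ 2 := Finset.card_le_two
    rw [Finset.card_univ, hcard] at h1
    omega
  have hγb : γ₀ • b = conjugate b := by
    rcases QuarticCM.eq_or_eq_or_eq_or_eq h4 hba hba' (γ₀ • b) with h | h | h | h
    · have : γ₀ • b = γ₀ • conjugate a := by rw [h, hconjK, hac]; exact (ComplexEmbedding.involutive_conjugate K a).symm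
      exact absurd (smul_left_cancel γ₀ this) hba'
    · exact absurd (smul_left_cancel γ₀ (h.trans hac.symm)) hba
    · exact absurd h (hfixK b)
    · exact h
  have hallK : ∀ z : K →+* ℂ, γ₀ • z = (starRingAut : ℂ ≃+* ℂ) • z := fun z => by
    rw [conj_smul_eq_conjugate]
    rcases QuarticCM.eq_or_eq_or_eq_or_eq h4 hba hba' z with h | h | h | h <;> rw [h]
    · exact hac
    · rw [hconjK, hac]
    · exact hγb
    · rw [hconjK, hγb]
  have := forall_smul_eq_smul_of_normalClosure_eq hLL.symm hallK ψ₀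
  rw [hγψ', conj_smul_eq_conjugate] at this
  exact QuarticCM.conjugate_ne ψ₀ this.symm

omit [IsCMField K] in
/-- **`Stab(ψ₀)` acts on `Hom(K, ℂ)` through `{1, γ₀}`**: an automorphism fixing `ψ₀` acts on the embeddings of `K`
either trivially or as the edge reflection `γ₀`. [cite: Shimura1998, §8.4 Example (2)(C)] -/
theorem smul_eq_or_smul_eq_of_smul_eq (h4M : finrank ℚ M = 4)
    (hLL : normalClosure ℚ M ℂ = normalClosure ℚ K ℂ) {γ₀ : ℂ ≃+* ℂ} {ψ₀ t : M →+* ℂ} (hγψ : γ₀ • ψ₀ = ψ₀)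
    (ht₀ : t ≠ ψ₀) (ht₀' : t ≠ conjugate ψ₀) (hγt : γ₀ • t = conjugate t) {h : ℂ ≃+* ℂ} (hh : h • ψ₀ = ψ₀) :
    (∀ z : K →+* ℂ, h • z = z) ∨ (∀ z : K →+* ℂ, h • z = γ₀ • z) := by
  have hconj : ∀ (g : ℂ ≃+* ℂ) (x : M →+* ℂ), g • conjugate x = conjugate (g • x) := fun g x =>
    QuarticCM.smul_conjugate g x
  have hhc : h • conjugate ψ₀ = conjugate ψ₀ := by rw [hconj, hh]
  -- `h t ∈ {t, t̄}`
  have ht : h • t = t ∨ h • t = conjugate t := by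
    rcases QuarticCM.eq_or_eq_or_eq_or_eq h4M ht₀ ht₀' (h • t) with h' | h' | h' | h'
    · exact absurd (smul_left_cancel h (h'.trans hh.symm)) ht₀
    · exact absurd (smul_left_cancel h (h'.trans hhc.symm)) ht₀'
    · exact Or.inl h'
    · exact Or.inr h'
  rcases ht with ht | ht
  · left
    refine fun z => (forall_smul_eq_smul_of_normalClosure_eq hLL (n' := 1) (fun x => ?_) z).trans (one_smul _ _)
    rw [one_smul]
    rcases QuarticCM.eq_or_eq_or_eq_or_eq h4M ht₀ ht₀' x with h' | h' | h' | h' <;> rw [h']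
    · exact hh
    · exact hhc
    · exact ht
    · rw [hconj, ht]
  · right
    refine fun z => forall_smul_eq_smul_of_normalClosure_eq hLL (fun x => ?_) z
    rcases QuarticCM.eq_or_eq_or_eq_or_eq h4M ht₀ ht₀' x with h' | h' | h' | h' <;> rw [h']
    · rw [hh, hγψ]
    · rw [hhc, hconj, hγψ]
    · rw [ht, hγt]
    · rw [hconj, ht, hconj, hγt]

/-! ## §2 Types of both kinds -/

/-- A two-element set `{a, c}` with `c ∉ {a, ā}` is a CM type of the quartic CM field `K`. [folklore] -/
private theorem pair_mem_iff (h4 : finrank ℚ K = 4) {a c : K →+* ℂ} (hca : c ≠ a) (hca' : c ≠ conjugate a)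
    (φ : K →+* ℂ) : φ ∈ ({a, c} : Set (K →+* ℂ)) ↔ conjugate φ ∉ ({a, c} : Set (K →+* ℂ)) := by
  have hcc : conjugate c ≠ c := QuarticCM.conjugate_ne c
  have haa : conjugate a ≠ a := QuarticCM.conjugate_ne a
  have hac' : conjugate c ≠ a := fun h =>
    hca' ((ComplexEmbedding.involutive_conjugate K c).symm.trans (congrArg conjugate h))
  simp only [Set.mem_insert_iff, Set.mem_singleton_iff]
  rcases QuarticCM.eq_or_eq_or_eq_or_eq h4 hca hca' φ with rfl | rfl | rfl | rfl
  · exact ⟨fun _ => fun h => h.elim haa (fun h => hca' h.symm), fun _ => Or.inl rfl⟩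
  · refine ⟨fun h => ?_, fun h => ?_⟩
    · exact (h.elim haa (fun h' => hca' h'.symm)).elim
    · rw [ComplexEmbedding.involutive_conjugate K a] at h; exact (h (Or.inl rfl)).elim
  · exact ⟨fun _ => fun h => h.elim hac' hcc, fun _ => Or.inr rfl⟩
  · refine ⟨fun h => ?_, fun h => ?_⟩
    · exact (h.elim hac' hcc).elim
    · rw [ComplexEmbedding.involutive_conjugate K c] at h; exact (h (Or.inr rfl)).elim

/-- **Both behaviours occur.**  `K`, `M` non-isomorphic non-Galois quartic CM fields with the same Galois closure,
`ψ₀ : M → ℂ`: there is a CM type `Ψ` of `K` STABILISED by every automorphism of `ℂ` fixing `ψ₀` (namely `{a, γ₀a}`),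
and a CM type `Ψ'` of `K` MOVED by some automorphism fixing `ψ₀` (namely `{a, \overline{γ₀a}}`).  With
`QuarticCMReflexInOcticHodge`: for every CM fourfold of the reflex configuration with nondegenerate type, surfaces with
CM by `K` of the first kind give DEGENERATE pairs (exceptional Hodge classes on some `S^a × F^b`) and surfaces of the
second kind give nondegenerate pairs (`B• = D•` on all `S^a × F^b`). [cite: Shimura1998, §8.3 Prop. 28, §8.4 Example (2)(C)]
[cite: MoonenZarhin1999LowDim, "Hodge groups of simple abelian surfaces of CM-type"] -/
theorem exists_cmType_stabilizer_and_exists_not (h4 : finrank ℚ K = 4) (hK : ¬ IsGalois ℚ K) (h4M : finrank ℚ M = 4)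
    (hM : ¬ IsGalois ℚ M) (hLL : normalClosure ℚ M ℂ = normalClosure ℚ K ℂ) (hKM : IsEmpty (K →+* M))
    (ψ₀ : M →+* ℂ) :
    (∃ Ψ : CMType K, ∀ h : ℂ ≃+* ℂ, h • ψ₀ = ψ₀ → ∀ z : K →+* ℂ, h • z ∈ Ψ.1 ↔ z ∈ Ψ.1) ∧
      ∃ Ψ' : CMType K, ∃ h : ℂ ≃+* ℂ, h • ψ₀ = ψ₀ ∧ ∃ z : K →+* ℂ, ¬(h • z ∈ Ψ'.1 ↔ z ∈ Ψ'.1) := by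
  obtain ⟨γ₀, t, hγψ, ht₀, ht₀', hγt, hγK⟩ := exists_edgeReflection h4 hK h4M hM hLL hKM ψ₀
  obtain ⟨a⟩ : Nonempty (K →+* ℂ) := inferInstance
  obtain ⟨hγa, hγa', hγγa⟩ := hγK a
  refine ⟨⟨⟨{a, γ₀ • a}, pair_mem_iff h4 hγa hγa'⟩, fun h hh z => ?_⟩, ?_⟩
  · -- `Stab(ψ₀)` acts through `{1, γ₀}`, and `{a, γ₀a}` is `γ₀`-stable
    rcases smul_eq_or_smul_eq_of_smul_eq (K := K) h4M hLL hγψ ht₀ ht₀' hγt hh with htriv | hγ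
    · rw [htriv z]
    · rw [hγ z]
      change γ₀ • z ∈ ({a, γ₀ • a} : Set (K →+* ℂ)) ↔ z ∈ ({a, γ₀ • a} : Set (K →+* ℂ))
      simp only [Set.mem_insert_iff, Set.mem_singleton_iff]
      constructor
      · rintro (h1 | h1)
        · right; rw [← (hγK z).2.2, h1]
        · left; exact smul_left_cancel γ₀ h1
      · rintro (rfl | rfl)
        · exact Or.inr rfl
        · exact Or.inl hγγa
  · -- `{a, \overline{γ₀ a}}` is moved by `γ₀`
    have hca : conjugate (γ₀ • a) ≠ a := fun h =>
      hγa' ((ComplexEmbedding.involutive_conjugate K (γ₀ • a)).symm.trans (congrArg conjugate h))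
    have hca' : conjugate (γ₀ • a) ≠ conjugate a := fun h =>
      hγa ((ComplexEmbedding.involutive_conjugate K).injective h)
    refine ⟨⟨{a, conjugate (γ₀ • a)}, pair_mem_iff h4 hca hca'⟩, γ₀, hγψ, a, fun h => ?_⟩
    have ha : a ∈ ({a, conjugate (γ₀ • a)} : Set (K →+* ℂ)) := Or.inl rfl
    have hγa_mem := h.2 ha
    change γ₀ • a ∈ ({a, conjugate (γ₀ • a)} : Set (K →+* ℂ)) at hγa_mem
    rcases hγa_mem with h1 | h1
    · exact hγa h1
    · exact QuarticCM.conjugate_ne (γ₀ • a) h1.symm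

end Summit.HodgeConjecture.CorCM

end
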